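import Literature.MathematicalPhysics.QuantumLattice.HubbardHalfFilledPseudospinSinglet
import HarnessLib

/-!
# Yang's `η`-pair energy ladder and the `η`-LOWEST-WEIGHT CRITERION for sector ground states
# away from half filling

Family `hubbard` (topic `MathematicalPhysics/QuantumLattice`); companion of
`HubbardHalfFilledPseudospinSinglet.lean` (which proves `η ψ = η† ψ = 0` AT half filling, from
Lieb's theorem) and of `HubbardHighestWeightCertificate.lean` (soundness of ANNIHILATOR rows
`Σᵢ (Rᵢ Gᵢ + Gᵢᴴ R'ᵢ)` with `Gᵢ ψ = 0` in sector-mode bootstrap certificates,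
`re_dotProduct_ge_of_sector_certificate_annihilators`). Everything PROVED; no definition, no named
fact, no `sorry`.

**Setting.** `H = hamiltonian G t U` on the fermionic Fock space of a finite graph `G`, a sign
`ε : Λ → {±1}` that is bipartite for `G` (`ε_x = -ε_y` on every bond), Yang's pair operators
`η†_ε = Σ_x ε_x c†_{x↑} c†_{x↓}` (`etaRaise ε`) and `η_ε = (η†_ε)ᴴ` (`etaLower ε`).

**Content.**
* `hamiltonian_mulVec_etaLower_mulVec` — **the energy ladder**: from Yang's commutator
  `[H, η†_ε] = U η†_ε` (tree: `hamiltonian_commutator_etaRaise`, [Yang1989, eq. (6)]) and its adjoint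
  `[H, η_ε] = -U η_ε`, an eigenvector `H ψ = E ψ` is mapped to `H (η_ε ψ) = (E - U) (η_ε ψ)` — Yang's
  eq. (7) read downwards (`η` REMOVES a pair and LOWERS the canonical energy by `U`; in the
  particle–hole symmetric normalisation of [EsslerEtAl2005, (2.31)] this is `[H, η^α] = 0`, (2.84),
  and the shift is carried by the chemical-potential term, (2.87) `[N̂, η^±] = ±2η^±`).
* `groundEnergyAt_le_of_etaLower_mulVec_ne_zero` — hence if `ψ` is an `(N+2)`-particle
  eigenvector with real eigenvalue `E` and `η_ε ψ ≠ 0`, then `E₀(N) ≤ E - U` (variational principle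
  in the `N`-sector, tree `groundEnergy_mul_norm_le`).
* `etaLower_mulVec_eq_zero_of_lt` — **the lowest-weight criterion**: `E - U < E₀(N)` forces
  `η_ε ψ = 0`; in particular (`etaLower_mulVec_eq_zero_of_groundState_of_lt`) every ground state of
  the `(N+2)`-sector is annihilated by `η_ε` as soon as `E₀(N+2) - U < E₀(N)` — i.e. as soon as
  Yang's raising bound `E₀(N+2) ≤ E₀(N) + U` is NOT saturated (the pair chemical potential is
  strictly below `U`). This is the licence for `η`-annihilator rows BELOW (or above) half filling:
  it is CONDITIONAL on a certified energy inequality between two sectors, nothing else (no sign of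
  `U`, no connectedness, no parity of `|Λ|`).
* `hubbardTorus_etaLower_mulVec_eq_zero_of_lt` — the square-torus instance (`L` even, Yang's
  staggering `torusStagger`, tree `torusStagger_eq_neg_of_adj_holds`).

Why a separate file: at half filling the conclusion is UNCONDITIONAL (Lieb ⇒ pseudospin singlet,
`hubbardTorus_eta_mulVec_eq_zero`); away from half filling only the conditional criterion holds,
and it is what a doped (`n = 7/8`) certificate may use once `E₀(N+2) - U < E₀(N)` is certified
from two-sided energy windows. The matching UPPER inequality `E₀(N+2) ≤ E₀(N) + U` (sharpness of
the criterion) is the summit-side `minEnergyOn_pairAdded_le`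
(`Summits/HubbardSuperconductivity/…/EnslavedA1gPairChemicalPotentialWindow.lean`) and is not
repeated here (Literature does not import Summits). The `S^z = 0`-sector, `t = 1`, square-torus
form of the criterion is already proved summit-side
(`Summits/HubbardSuperconductivity/…/Cruxes/MesoscopicPairOrder/SketchIdeator4.lean`,
`lowestWeightCriterion_holds`, with `minEnergyOn (szSector · 0)`); the present file is the
graph-general, `N`-sector (`groundEnergyAt`), arbitrary-`t` Literature statement that cell-side
certificates cite.

References: C. N. Yang, *η pairing and off-diagonal long-range order in a Hubbard model*, Phys.
Rev. Lett. 63 (1989) 2144, eqs. (6)–(7); F. H. L. Essler, H. Frahm, F. Göhmann, A. Klümper,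
V. E. Korepin, *The One-Dimensional Hubbard Model* (CUP 2005), §2.2.5 eqs. (2.80)–(2.87) and
Appendix 3.F (lowest-weight theorem for the η-pairing symmetry) [held: `lit read
book:essler2005-one-dimensional-hubbard-model`, PDF pp. 65–67, 135]; S. C. Zhang, Phys. Rev.
Lett. 65 (1990) 120 (pseudospin SU(2)).
-/

noncomputable section

namespace Literature.MathematicalPhysics.QuantumLattice

open Matrix Finset LiebThm1
open scoped ComplexOrder

section General

variable {Λ : Type*} [LinearOrder Λ] [Fintype Λ]
variable {G : SimpleGraph Λ} [DecidableRel G.Adj]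

/-- **Yang's energy ladder, lowering direction**: on a bipartite-signed graph, `H ψ = E ψ` implies
`H (η_ε ψ) = (E - U) (η_ε ψ)` (from `[H, η†_ε] = U η†_ε` and `H = Hᴴ`).
[cite: Yang1989, eqs. (6)–(7)] [cite: EsslerEtAl2005, §2.2.5 (2.84), (2.87)] -/
theorem hamiltonian_mulVec_etaLower_mulVec (ε : Λ → ℤˣ) (hε : ∀ x y : Λ, G.Adj x y → ε x = -ε y)
    (t U : ℝ) {ψ : Fock (Orb Λ)} {E : ℂ} (hHψ : hamiltonian G t U *ᵥ ψ = E • ψ) :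
    hamiltonian G t U *ᵥ (etaLower ε *ᵥ ψ) = (E - (U : ℂ)) • (etaLower ε *ᵥ ψ) := by
  have h1 : hamiltonian G t U * etaRaise ε = etaRaise ε * hamiltonian G t U + (U : ℂ) • etaRaise ε := by
    rw [← hamiltonian_commutator_etaRaise G ε hε t U]; abel
  have hH : (hamiltonian G t U)ᴴ = hamiltonian G t U := (hamiltonian_isHermitian G t U).eq
  have h2 : etaLower ε * hamiltonian G t U = hamiltonian G t U * etaLower ε + (U : ℂ) • etaLower ε := by
    have h := congrArg conjTranspose h1
    rw [conjTranspose_mul, conjTranspose_add, conjTranspose_mul, conjTranspose_smul, hH,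
      Complex.star_def, Complex.conj_ofReal, show (etaRaise ε)ᴴ = etaLower ε from rfl] at h
    exact h
  have h3 : hamiltonian G t U * etaLower ε = etaLower ε * hamiltonian G t U - (U : ℂ) • etaLower ε :=
    eq_sub_of_add_eq h2.symm
  calc hamiltonian G t U *ᵥ (etaLower ε *ᵥ ψ)
      = (hamiltonian G t U * etaLower ε) *ᵥ ψ := by rw [mulVec_mulVec]
    _ = (etaLower ε * hamiltonian G t U - (U : ℂ) • etaLower ε) *ᵥ ψ := by rw [h3]
    _ = etaLower ε *ᵥ (hamiltonian G t U *ᵥ ψ) - (U : ℂ) • (etaLower ε *ᵥ ψ) := by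
        rw [sub_mulVec, Matrix.smul_mulVec, mulVec_mulVec]
    _ = (E - (U : ℂ)) • (etaLower ε *ᵥ ψ) := by
        rw [hHψ, mulVec_smul, sub_smul]

/-- The expectation of `H` in `η_ε ψ` for an eigenvector `H ψ = E ψ`:
`⟨η ψ, H η ψ⟩ = (E - U) ‖η ψ‖²`. [cite: Yang1989, eqs. (6)–(7)] -/
theorem expect_hamiltonian_etaLower_mulVec (ε : Λ → ℤˣ) (hε : ∀ x y : Λ, G.Adj x y → ε x = -ε y)
    (t U : ℝ) {ψ : Fock (Orb Λ)} {E : ℂ} (hHψ : hamiltonian G t U *ᵥ ψ = E • ψ) :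
    expect (hamiltonian G t U) (etaLower ε *ᵥ ψ) =
      (E - (U : ℂ)) * (star (etaLower ε *ᵥ ψ) ⬝ᵥ (etaLower ε *ᵥ ψ)) := by
  rw [expect, hamiltonian_mulVec_etaLower_mulVec ε hε t U hHψ, dotProduct_smul, smul_eq_mul]

/-- **If `η_ε ψ ≠ 0` for an `(N+2)`-particle eigenvector with real eigenvalue `E`, then
`E₀(N) ≤ E - U`** (`η_ε ψ` is an `N`-particle eigenvector of energy `E - U`; variational
principle). [cite: Yang1989, eqs. (6)–(7)] [cite: EsslerEtAl2005, §2.2.5 (2.87)] -/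
theorem groundEnergyAt_le_of_etaLower_mulVec_ne_zero (ε : Λ → ℤˣ)
    (hε : ∀ x y : Λ, G.Adj x y → ε x = -ε y) (t U : ℝ) {N : ℕ} {ψ : Fock (Orb Λ)} {E : ℝ}
    (hN : IsNParticle (N + 2) ψ) (hHψ : hamiltonian G t U *ᵥ ψ = (E : ℂ) • ψ)
    (hne : etaLower ε *ᵥ ψ ≠ 0) :
    groundEnergyAt G t U N ≤ E - U := by
  set φ : Fock (Orb Λ) := etaLower ε *ᵥ ψ with hφ
  have hφN : IsNParticle N φ := by
    simpa using isNParticle_etaLower_mulVec ε hN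
  have hvar := groundEnergy_mul_norm_le (hamiltonian G t U) hφN
  have hexp : (expect (hamiltonian G t U) φ).re = (E - U) * (star φ ⬝ᵥ φ).re := by
    rw [hφ, expect_hamiltonian_etaLower_mulVec ε hε t U hHψ, ← hφ]
    have hr : ((E : ℂ) - (U : ℂ)) = ((E - U : ℝ) : ℂ) := by push_cast; ring
    rw [hr, Complex.re_ofReal_mul]
  have hpos : 0 < (star φ ⬝ᵥ φ).re := by
    have h1 : 0 < star φ ⬝ᵥ φ :=
      lt_of_le_of_ne (dotProduct_star_self_nonneg φ) (Ne.symm (mt dotProduct_star_self_eq_zero.1 hne))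
    exact (Complex.pos_iff.1 h1).1
  rw [hexp] at hvar
  exact le_of_mul_le_mul_right (by simpa [groundEnergyAt] using hvar) hpos

/-- **η-LOWEST-WEIGHT CRITERION.** On a bipartite-signed graph, an `(N+2)`-particle eigenvector
`H ψ = E ψ` with `E - U < E₀(N)` satisfies `η_ε ψ = 0`.
[cite: Yang1989, eqs. (6)–(7)] [cite: EsslerEtAl2005, §2.2.5 and App. 3.F (lowest-weight states of the η-pairing SU(2))] -/
theorem etaLower_mulVec_eq_zero_of_lt (ε : Λ → ℤˣ) (hε : ∀ x y : Λ, G.Adj x y → ε x = -ε y)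
    (t U : ℝ) {N : ℕ} {ψ : Fock (Orb Λ)} {E : ℝ} (hN : IsNParticle (N + 2) ψ)
    (hHψ : hamiltonian G t U *ᵥ ψ = (E : ℂ) • ψ) (hlt : E - U < groundEnergyAt G t U N) :
    etaLower ε *ᵥ ψ = 0 := by
  by_contra hne
  exact absurd (groundEnergyAt_le_of_etaLower_mulVec_ne_zero ε hε t U hN hHψ hne) (not_le.2 hlt)

/-- **Sector ground states are η-lowest-weight when the pair chemical potential is below `U`.**
If `ψ` is a ground vector of the `(N+2)`-particle sector (`H ψ = E₀(N+2) ψ`) and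
`E₀(N+2) - U < E₀(N)`, then `η_ε ψ = 0`; hence every annihilator row built on `Gᵢ = η_ε` is a
valid null row for `ψ` (`HubbardHighestWeightCertificate`,
`re_dotProduct_ge_of_sector_certificate_annihilators`).
[cite: Yang1989, eqs. (6)–(7)] [cite: EsslerEtAl2005, App. 3.F] -/
theorem etaLower_mulVec_eq_zero_of_groundState_of_lt (ε : Λ → ℤˣ)
    (hε : ∀ x y : Λ, G.Adj x y → ε x = -ε y) (t U : ℝ) {N : ℕ} {ψ : Fock (Orb Λ)}
    (hN : IsNParticle (N + 2) ψ)
    (hHψ : hamiltonian G t U *ᵥ ψ = ((groundEnergyAt G t U (N + 2) : ℝ) : ℂ) • ψ)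
    (hlt : groundEnergyAt G t U (N + 2) - U < groundEnergyAt G t U N) :
    etaLower ε *ᵥ ψ = 0 :=
  etaLower_mulVec_eq_zero_of_lt ε hε t U hN hHψ hlt

/-- Null rows from the criterion: `⟨ψ, X η_ε ψ⟩ = 0` for every operator `X`.
[cite: Yang1989, eqs. (6)–(7)] -/
theorem expect_mul_etaLower_eq_zero_of_lt (ε : Λ → ℤˣ) (hε : ∀ x y : Λ, G.Adj x y → ε x = -ε y)
    (t U : ℝ) {N : ℕ} {ψ : Fock (Orb Λ)} {E : ℝ} (hN : IsNParticle (N + 2) ψ)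
    (hHψ : hamiltonian G t U *ᵥ ψ = (E : ℂ) • ψ) (hlt : E - U < groundEnergyAt G t U N)
    (X : Matrix (Finset (Orb Λ)) (Finset (Orb Λ)) ℂ) :
    expect (X * etaLower ε) ψ = 0 := by
  rw [expect, ← mulVec_mulVec, etaLower_mulVec_eq_zero_of_lt ε hε t U hN hHψ hlt, mulVec_zero,
    dotProduct_zero]

end General

/-! ### The even square torus -/

section Torus

variable {L : ℕ}

/-- **Square torus `(ℤ/Lℤ)²`, `L` even, Yang's staggering `ε_x = (-1)^{x₁+x₂}`**: an
`(N+2)`-particle eigenvector `H ψ = E ψ` of `hamiltonian (fermionTorusGraph 2 L) t U` with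
`E - U < E₀(N)` has `η ψ = 0`; in particular every `(N+2)`-sector ground state when
`E₀(N+2) - U < E₀(N)`. (Any real `t`, `U`; no half-filling hypothesis.)
[cite: Yang1989, eqs. (6)–(7)] [cite: EsslerEtAl2005, App. 3.F] -/
theorem hubbardTorus_etaLower_mulVec_eq_zero_of_lt (hL : Even L) (t U : ℝ) {N : ℕ}
    {ψ : Fock (Orb (FermionTorus 2 L))} {E : ℝ} (hN : IsNParticle (N + 2) ψ)
    (hHψ : hamiltonian (fermionTorusGraph 2 L) t U *ᵥ ψ = (E : ℂ) • ψ)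
    (hlt : E - U < groundEnergyAt (fermionTorusGraph 2 L) t U N) :
    etaLower (torusStagger (d := 2) (L := L)) *ᵥ ψ = 0 :=
  etaLower_mulVec_eq_zero_of_lt torusStagger
    (fun _ _ h => torusStagger_eq_neg_of_adj_holds hL h) t U hN hHψ hlt

end Torus

end Literature.MathematicalPhysics.QuantumLattice

end
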